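import Mathlib
import HarnessLib

/-!
# Crux `IsobarTomography.BlobRiccatiClosure` (stmt-NavierStokesRegularity-11740), line
# `type-i-apex-liouville`, stub B1 `stub_limsupTimes` — limsup times of a bounded gauge function

Registered stub B1 of the extremal-apex zoom (pure real analysis, folklore): a function
`m : ℝ → ℝ` with `c ≤ m ≤ C` on `[t₂, T)` (`t₂ < T`) has a value `G ∈ [c, C]` — its `limsup` at
`T⁻` — which is the limit of `m` along some sequence `t_k → T`, `t_k ∈ [t₂, T)`, and which
bounds `m` from above near `T` up to every `ε > 0`.

On the line this is used with the scale-invariant vorticity gauge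
`m(t) = (T − t) sup_x ‖ω(t, x)‖` of a Type-I blow-up (two-sided vorticity rate), to place the zoom
times at the EXTREMAL level `G = limsup_{t → T⁻} m(t)`, so that the blow-up limit's
scale-invariant vorticity is globally maximised at the marked point.

Proof. Let `F = 𝓝[<] T` (a non-trivial filter on `ℝ`). Since `Ioo t₂ T ∈ F`, eventually along
`F` we have `c ≤ m ≤ C`, so `m` is bounded and cobounded under `≤` along `F`; put
`G := limsup m F`. Then `c ≤ G ≤ C`; for every `ε > 0`, eventually `m < G + ε` (hence on some
`Ioo T' T`, `T' < T`) and frequently `G − ε < m`. Combining these at `ε = 1/(k+1)` with the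
eventual facts `t ∈ Ioo t₂ T`, `t ∈ Ioo (T − 1/(k+1)) T` yields `t_k ∈ [t₂, T)` with
`|t_k − T| ≤ 1/(k+1)` and `|m(t_k) − G| ≤ 1/(k+1)`, whence both limits by squeezing.

References: folklore (elementary properties of `limsup` along a filter: Mathlib's
`Filter.eventually_lt_of_limsup_lt`, `Filter.frequently_lt_of_lt_limsup`,
`Filter.le_limsup_of_frequently_le`, `Filter.limsup_le_of_le`).
-/

noncomputable section

open Set Filter Topology

-- the summit and its single sub-problem share the name (CONVENTIONS §1), as in every Theorems file
set_option linter.dupNamespace false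

namespace Summit.NavierStokesRegularity.NavierStokesRegularity.Theorems.BlobRiccatiClosure.TypeIApexLiouville

/-- **Eventual facts at `T⁻` hold on an open interval.** If `P` holds eventually along `𝓝[<] T`
then there is `T' < T` with `P` on `Ioo T' T`. [folklore] -/
theorem exists_Ioo_of_eventually_nhdsLT {T : ℝ} {P : ℝ → Prop} (h : ∀ᶠ t in 𝓝[<] T, P t) :
    ∃ T' : ℝ, T' < T ∧ ∀ t ∈ Ioo T' T, P t := by
  obtain ⟨T', hT', hsub⟩ := mem_nhdsLT_iff_exists_Ioo_subset.1 h
  exact ⟨T', hT', fun t ht => hsub ht⟩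

/-- **The `limsup` at `T⁻` of a function bounded on `[t₂, T)`.** With `G := limsup m (𝓝[<] T)`:
`c ≤ G ≤ C`, for every `ε > 0` eventually `m < G + ε`, and for every `ε > 0` frequently
`G − ε < m` (all along `𝓝[<] T`). [folklore] -/
theorem limsup_nhdsLT_bounds (m : ℝ → ℝ) {c C t₂ T : ℝ} (ht₂ : t₂ < T)
    (hm : ∀ t ∈ Ico t₂ T, c ≤ m t ∧ m t ≤ C) :
    c ≤ limsup m (𝓝[<] T) ∧ limsup m (𝓝[<] T) ≤ C ∧
      (∀ ε : ℝ, 0 < ε → ∀ᶠ t in 𝓝[<] T, m t < limsup m (𝓝[<] T) + ε) ∧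
      (∀ ε : ℝ, 0 < ε → ∃ᶠ t in 𝓝[<] T, limsup m (𝓝[<] T) - ε < m t) := by
  have hev : ∀ᶠ t in 𝓝[<] T, c ≤ m t ∧ m t ≤ C :=
    mem_of_superset (Ioo_mem_nhdsLT ht₂) fun t ht => hm t ⟨ht.1.le, ht.2⟩
  have hbdd : IsBoundedUnder (· ≤ ·) (𝓝[<] T) m :=
    isBoundedUnder_of_eventually_le (hev.mono fun t ht => ht.2)
  have hcobdd : IsCoboundedUnder (· ≤ ·) (𝓝[<] T) m :=
    isCoboundedUnder_le_of_eventually_le _ (hev.mono fun t ht => ht.1)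
  refine ⟨?_, ?_, ?_, ?_⟩
  · exact le_limsup_of_frequently_le (hev.mono fun t ht => ht.1).frequently hbdd
  · exact limsup_le_of_le hcobdd (hev.mono fun t ht => ht.2)
  · intro ε hε
    exact eventually_lt_of_limsup_lt (by linarith) hbdd
  · intro ε hε
    exact frequently_lt_of_lt_limsup hcobdd (by linarith)

/-- **Approximate limsup times.** Under the hypotheses of `limsup_nhdsLT_bounds`, for every
`δ > 0` there is `t ∈ [t₂, T)` with `|t − T| ≤ δ` and `|m t − G| ≤ δ`, `G := limsup m (𝓝[<] T)`.
[folklore] -/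
theorem exists_near_limsup_nhdsLT (m : ℝ → ℝ) {c C t₂ T : ℝ} (ht₂ : t₂ < T)
    (hm : ∀ t ∈ Ico t₂ T, c ≤ m t ∧ m t ≤ C) {δ : ℝ} (hδ : 0 < δ) :
    ∃ t : ℝ, t ∈ Ico t₂ T ∧ |t - T| ≤ δ ∧ |m t - limsup m (𝓝[<] T)| ≤ δ := by
  obtain ⟨-, -, hup, hlow⟩ := limsup_nhdsLT_bounds m ht₂ hm
  have h1 : ∀ᶠ t in 𝓝[<] T, t ∈ Ioo t₂ T := Ioo_mem_nhdsLT ht₂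
  have h2 : ∀ᶠ t in 𝓝[<] T, t ∈ Ioo (T - δ) T := Ioo_mem_nhdsLT (by linarith)
  obtain ⟨t, hlt, ht1, ht2, ht3⟩ :=
    ((hlow δ hδ).and_eventually (h1.and (h2.and (hup δ hδ)))).exists
  refine ⟨t, ⟨ht1.1.le, ht1.2⟩, ?_, ?_⟩
  · rw [abs_le]
    constructor <;> linarith [ht2.1, ht2.2]
  · rw [abs_le]
    constructor <;> linarith

/-- **B1, LIMSUP TIMES (real analysis).** A function `m` with `c ≤ m ≤ C` on `[t₂, T)` has a
value `G ∈ [c, C]` (its `limsup` at `T⁻`) which is the limit of `m` along some sequence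
`t_k → T`, `t_k ∈ [t₂, T)`, and which bounds `m` from above near `T` up to every `ε > 0`.
Used with `m(t) = (T − t) sup_x ‖ω(t, x)‖` (two-sided vorticity rate) to place the zoom
times at the EXTREMAL level `G`, so that the limit's scale-invariant vorticity is globally
maximised at the marked point. [folklore] -/
theorem stub_limsupTimes :
    ∀ (m : ℝ → ℝ) (c C t₂ T : ℝ), t₂ < T → (∀ t ∈ Ico t₂ T, c ≤ m t ∧ m t ≤ C) →
      ∃ G : ℝ, c ≤ G ∧ G ≤ C ∧
        (∃ tk : ℕ → ℝ, (∀ k, tk k ∈ Ico t₂ T) ∧ Tendsto tk atTop (𝓝 T) ∧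
          Tendsto (fun k => m (tk k)) atTop (𝓝 G)) ∧
        ∀ ε : ℝ, 0 < ε → ∃ T' : ℝ, T' < T ∧ ∀ t ∈ Ioo T' T, m t ≤ G + ε := by
  intro m c C t₂ T ht₂ hm
  obtain ⟨hcG, hGC, hup, -⟩ := limsup_nhdsLT_bounds m ht₂ hm
  refine ⟨limsup m (𝓝[<] T), hcG, hGC, ?_, ?_⟩
  · have hpt : ∀ k : ℕ, ∃ t : ℝ, t ∈ Ico t₂ T ∧ |t - T| ≤ 1 / ((k : ℝ) + 1) ∧
        |m t - limsup m (𝓝[<] T)| ≤ 1 / ((k : ℝ) + 1) := fun k =>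
      exists_near_limsup_nhdsLT m ht₂ hm Nat.one_div_pos_of_nat
    choose tk htk using hpt
    have h0 : Tendsto (fun k : ℕ => 1 / ((k : ℝ) + 1)) atTop (𝓝 0) :=
      tendsto_one_div_add_atTop_nhds_zero_nat
    refine ⟨tk, fun k => (htk k).1, ?_, ?_⟩
    · rw [tendsto_iff_norm_sub_tendsto_zero]
      refine squeeze_zero (fun k => norm_nonneg _) (fun k => ?_) h0
      rw [Real.norm_eq_abs]
      exact (htk k).2.1
    · rw [tendsto_iff_norm_sub_tendsto_zero]
      refine squeeze_zero (fun k => norm_nonneg _) (fun k => ?_) h0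
      rw [Real.norm_eq_abs]
      exact (htk k).2.2
  · intro ε hε
    obtain ⟨T', hT', hP⟩ := exists_Ioo_of_eventually_nhdsLT (hup ε hε)
    exact ⟨T', hT', fun t ht => (hP t ht).le⟩

end Summit.NavierStokesRegularity.NavierStokesRegularity.Theorems.BlobRiccatiClosure.TypeIApexLiouville
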